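import Summits.HodgeConjecture.HodgeConjecture.Theorems.Ring2DeformPrintedFamilies
import HarnessLib

/-!
# Ring 2 · AbelianAll · SPREAD axis — the spreading candidates for `B_min`, their order, and which of
# them leave `HC_CM` load-bearing

HONEST FRAMING: research route, not a corollary; conditional on HC_CM plus one named minimal statement.
(Cell-wide: research route conditional on HC_CM; not a corollary; Q11.4-sentence-2 already refuted in dim ≥ 3.)

Cell `pub-hodge-ring2`, sub-cell AbelianAll, seat `pub-hodge-ring2-ab-spread-1`. `HC_CM` is ALWAYS the explicit
hypothesis `Theses.RankFourFaces.CMAbelianHodge` (tree item stmt-HodgeConjecture-3052) — a binder, never an axiom,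
never cited; `HC_AV` is the tree item `Theses.PadicSemiregularLift.HodgeAbelianVarieties` (stmt-HodgeConjecture-1333);
the reduction `HC_CM → HC_AV` is the OPEN item `Theses.RankFourFaces.CMToAbelian` (stmt-HodgeConjecture-16267) and is
NOT re-filed here. Nothing in this file proves a case of the Hodge conjecture. Sorry-free; axioms `propext`,
`Classical.choice`, `Quot.sound` only.

## What this file adds to the deform seat's row U (`Ring2DeformUniformAlgebraicity`, `Ring2DeformPrintedFamilies`)

The deform seat typed the spreading input U = `Ring2.Deform.UniformAlgebraicityAtCMPoints` ("on a CM-dense abelian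
family, a fibrewise-Hodge global class algebraic at EVERY CM fibre is uniformly algebraic along the CM locus") and
proved the exactness `HC_AV ↔ HC_CM ∧ U` granted the refereed family fact
`Deligne1982.deligne1982_cmDenseMumfordTateFamilies` (Charles–Schnell Thm. 11.5.11 with density). The AbelianAll
brief asks for the SMALLEST named `B_min` with `HC_CM → B_min → HC(abelian varieties)` and names as its spreading
example "a flat section … algebraic at a Zariski-dense SET of CM points is algebraic everywhere". This file:

* §1 `zariskiClosureOnPoints Λ` (a `Set`) — Zariski density of a set of complex points, ON POINTS, is
  `zariskiClosureOnPoints Λ = Set.univ` (every Zariski-closed `Z ⊆ S` with `Λ ⊆ Z(ℂ)` has `Z(ℂ) = S(ℂ)`); analytic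
  density implies it (GAGA: `isClosed_setOf_pt_mem`), and it is EXACTLY what the one-closed-stratum spreading
  mechanism consumes (`forall_mem_algebraicClasses_of_zariskiDense_of_subset_closed` is one line).
* §2 three typed spreading candidates on U's carriers, from strong to weak:
  `SpreadFromZariskiDenseCMPoints` (S_ZD — the brief's sentence: algebraic on SOME Zariski-dense set of CM fibres
  ⟹ algebraic at every fibre), `SpreadFromZariskiDenseCMLocus` (U_Z — algebraic at ALL CM fibres of a family whose
  CM locus is merely Zariski-dense ⟹ everywhere) and U itself; the kernel order
  `HC ⟹ HC_AV ⟹ AbelianSchemeVHC ⟹ S_ZD ⟹ U_Z ⟹ U`, and `U ⟹ U_Z` granted the André–Oort-shaped upgrade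
  `ZariskiDenseCMLocusIsDense` (typed hypothesis; an INFERENCE from Tsimerman 2018 / Pila–Shankar–Tsimerman, not
  verbatim print — the tree has no Shimura varieties, so André–Oort itself is not typable here).
* §3 each candidate is an EXACT complement of `HC_CM` granted the family fact (`HC_AV ↔ HC_CM ∧ X` for
  `X ∈ {S_ZD, U_Z, U}`), the brief's deliverable shape `HC_CM → X → ∀ A, HC(A)` for each, and the schema
  `complement_iff_uniform_of_HC_CM`: under `HC_CM` ALL exact complements are pairwise equivalent — so "smaller"
  can only mean "weaker STANDALONE", and standalone the weakest typed spreading input is U.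
* the companion file `Ring2AbelianAllSpreadDomination` proves THE HONEST FINDING about the brief's example: granted
  André 1992 (tree fact) and two typed DENSELY-ANCHORED Weil-family hypotheses, `S_ZD ⟹ HC_CM` — in
  `HC_CM + S_ZD ⟹ HC(AV)` the binder `HC_CM` is idle, exactly as for blanket VHC (deform part I (D)); the
  premise-at-ALL-CM-fibres forms U_Z, U are not visibly dominating (deform part II, HONEST COLUMN (1)), and that —
  not size — is what singles out U as the spread-side `B_min`.

References: [CharlesSchnell2014Notes] Conj. 11.3.1, Prop. 11.3.11, Cor. 11.3.6, Thm. 11.5.11; [Deligne1982HodgeCycles]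
Thm. 2.12, Thm. 4.8 (proof, pp. 50–51: "there is also an abelian variety of the form `A₀ ⊗ E` in the family … Let `A₀`
be any abelian variety of dimension `d/2`"), Prop. 6.1 (p. 59: "(b) will hold for a dense set of points");
[CattaniDeligneKaplan1995] Thm. 1.1, Cor. 1.2; [Tsimerman2018] (André–Oort for `𝒜_g`); [PilaEtAl2021] (general André–Oort); [Pila2022] Conj. 6.4, Thm. 6.6, Thm. 6.7;
[PlatonovRapinchuk1994] Thm. 7.7 (real approximation). PerL / QW8 / the 2001 programme are cited nowhere.
-/

-- every declaration of this problem lives in `Summit.HodgeConjecture.HodgeConjecture.…` (summit = sub-problem);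
-- the sub-cell asked for `Summits/HodgeConjecture/Ring2/AbelianAll/`; the namespace carries `Ring2.AbelianAll`.
set_option linter.dupNamespace false

noncomputable section

namespace Summit.HodgeConjecture.HodgeConjecture.Ring2.AbelianAll

open CategoryTheory AlgebraicGeometry
open Literature.AlgebraicGeometry Literature.AlgebraicGeometry.Motives
open Literature.AlgebraicGeometry.HodgeTheory
open Literature.AlgebraicGeometry.Deligne1982 (deligne1982_cmDenseMumfordTateFamilies)
open Literature.AlgebraicTopology.SingularHomology
open Summit.HodgeConjecture.HodgeConjecture
open Summit.HodgeConjecture.HodgeConjecture.Theses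
open Summit.HodgeConjecture.HodgeConjecture.Ring2.Hypotheses (AbelianSchemeVHC)
open Summit.HodgeConjecture.HodgeConjecture.Ring2.Deform

variable {𝒳 S : SchemeOver ℂ}

/-! ## §1 Zariski closure and Zariski density ON POINTS (a `Set`-valued definition, not an assertion) -/

/-- **The Zariski closure ON POINTS of a set `Λ ⊆ S(ℂ)` of complex points**: the complex points lying in every
Zariski-closed `Z ⊆ S` whose complex points contain `Λ`. `Λ` is ZARISKI-DENSE ON POINTS when
`zariskiClosureOnPoints Λ = Set.univ` — the on-points rendering (the tree's `Motives.IsZariskiClosedOnPoints` is the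
matching closedness notion) of "Zariski-dense set of points" in the brief's spreading sentence and in the André–Oort
conjecture ("a subvariety has a Zariski-dense set of special points iff it is special"). A `Set`-valued definition.
[cite: Pila2022, Conj. 6.4 (p. 41)] [cite: CattaniDeligneKaplan1995, Cor. 1.2] -/
def zariskiClosureOnPoints (Λ : Set (ComplexPoints S)) : Set (ComplexPoints S) :=
  {t | ∀ Z : Set S.left, IsClosed Z → (∀ s ∈ Λ, s.pt ∈ Z) → t.pt ∈ Z}

/-- Membership in the Zariski closure on points, unfolded. [folklore] -/
theorem mem_zariskiClosureOnPoints_iff {Λ : Set (ComplexPoints S)} {t : ComplexPoints S} :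
    t ∈ zariskiClosureOnPoints Λ ↔ ∀ Z : Set S.left, IsClosed Z → (∀ s ∈ Λ, s.pt ∈ Z) → t.pt ∈ Z :=
  Iff.rfl

/-- `Λ` lies in its Zariski closure on points. [folklore] -/
theorem subset_zariskiClosureOnPoints (Λ : Set (ComplexPoints S)) : Λ ⊆ zariskiClosureOnPoints Λ :=
  fun _ ht _ _ hΛZ => hΛZ _ ht

/-- The Zariski closure on points is monotone. [folklore] -/
theorem zariskiClosureOnPoints_mono {Λ Λ' : Set (ComplexPoints S)} (hsub : Λ ⊆ Λ') :
    zariskiClosureOnPoints Λ ⊆ zariskiClosureOnPoints Λ' :=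
  fun _ ht Z hZ hΛ'Z => ht Z hZ fun s hs => hΛ'Z s (hsub hs)

/-- Zariski density on points, unfolded: every closed `Z ⊇ Λ` (on points) contains every complex point. [folklore] -/
theorem zariskiClosureOnPoints_eq_univ_iff {Λ : Set (ComplexPoints S)} :
    zariskiClosureOnPoints Λ = Set.univ ↔
      ∀ Z : Set S.left, IsClosed Z → (∀ s ∈ Λ, s.pt ∈ Z) → ∀ t : ComplexPoints S, t.pt ∈ Z := by
  constructor
  · intro h Z hZ hΛZ t
    have ht : t ∈ zariskiClosureOnPoints Λ := by
      rw [h]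
      exact Set.mem_univ t
    exact ht Z hZ hΛZ
  · intro h
    exact Set.eq_univ_of_forall fun t Z hZ hΛZ => h Z hZ hΛZ t

/-- **Analytic density implies Zariski density on points** (the strong topology is finer than the Zariski
topology: `Z(ℂ)` is closed in `S(ℂ)`, `isClosed_setOf_pt_mem`; a closed set containing a dense set is everything).
The converse fails in general (`ℤ ⊂ 𝔸¹(ℂ)`); for CM loci it is the content of `ZariskiDenseCMLocusIsDense`.
[cite: SerreGAGA1956, §2] -/
theorem zariskiClosureOnPoints_eq_univ_of_dense {Λ : Set (ComplexPoints S)} (hΛ : Dense Λ) :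
    zariskiClosureOnPoints Λ = Set.univ := by
  refine zariskiClosureOnPoints_eq_univ_iff.2 fun Z hZ hΛZ t => ?_
  have huniv : {t : ComplexPoints S | t.pt ∈ Z} = Set.univ :=
    eq_univ_of_dense_of_subset_closed hΛ (isClosed_setOf_pt_mem hZ) fun s hs => hΛZ s hs
  have ht : t ∈ {t : ComplexPoints S | t.pt ∈ Z} := by
    rw [huniv]
    exact Set.mem_univ t
  exact ht

/-- Zariski density on points passes to supersets. [folklore] -/
theorem zariskiClosureOnPoints_eq_univ_mono {Λ Λ' : Set (ComplexPoints S)} (h : zariskiClosureOnPoints Λ = Set.univ)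
    (hsub : Λ ⊆ Λ') : zariskiClosureOnPoints Λ' = Set.univ :=
  Set.eq_univ_of_univ_subset (h ▸ zariskiClosureOnPoints_mono hsub)

/-- A set of points Zariski-dense on points, on a scheme WITH a complex point, is non-empty (`Z = ∅` is closed).
[folklore] -/
theorem nonempty_of_zariskiClosureOnPoints_eq_univ {Λ : Set (ComplexPoints S)}
    (h : zariskiClosureOnPoints Λ = Set.univ) (t : ComplexPoints S) : Λ.Nonempty := by
  by_contra hΛ
  rw [Set.not_nonempty_iff_eq_empty] at hΛ
  have ht : t.pt ∈ (∅ : Set S.left) :=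
    zariskiClosureOnPoints_eq_univ_iff.1 h ∅ isClosed_empty (fun s hs => by simp [hΛ] at hs) t
  exact (Set.mem_empty_iff_false _).mp ht

/-- **Spreading lemma, Zariski form (ONE closed stratum + Zariski-dense on points ⟹ everywhere)**: if a
Zariski-closed `W ⊆ S` consists of algebraic fibres of the global class `A` and contains the Zariski-dense `Λ`, then
`A|_{𝒳_t}` is algebraic at every `t ∈ S(ℂ)`. This is the precise sense in which uniform algebraicity (finitely many
relative-Hilbert strata; `Ring2.Deform.exists_closed_stratum_of_finite_strata`) needs only ZARISKI density of the
anchors, not analytic density (compare `Ring2.Deform.forall_mem_algebraicClasses_of_dense_of_subset_closed`).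
[cite: CharlesSchnell2014Notes, Prop. 11.3.11] [cite: VoisinHodgeII2003, §3.3.1] -/
theorem forall_mem_algebraicClasses_of_zariskiDense_of_subset_closed (f : 𝒳 ⟶ S) {p : ℕ}
    {A : complexBetti 𝒳 (2 * p)} {Λ : Set (ComplexPoints S)} (hΛ : zariskiClosureOnPoints Λ = Set.univ)
    {W : Set S.left} (hWc : IsClosed W)
    (hWalg : ∀ t : ComplexPoints S, t.pt ∈ W →
      complexBetti.map (fiberι f t) (2 * p) A ∈ algebraicClasses (fiberOver f t) p)
    (hΛW : ∀ t ∈ Λ, t.pt ∈ W) (t : ComplexPoints S) :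
    complexBetti.map (fiberι f t) (2 * p) A ∈ algebraicClasses (fiberOver f t) p :=
  hWalg t (zariskiClosureOnPoints_eq_univ_iff.1 hΛ W hWc hΛW t)

/-! ## §2 The three spreading candidates, typed on the carriers of row U -/

/-- **S_ZD — `SpreadFromZariskiDenseCMPoints` (the brief's spreading sentence, typed; OPEN; §4: DOMINATES `HC_CM`).**
For every smooth projective family `f : 𝒳 ⟶ S` of relative dimension `n` with `𝒳`, `S` quasi-projective, `S` smooth
irreducible and abelian charts at every fibre, and every global class `W ∈ H²ᵖ(𝒳(ℂ); ℂ)` fibrewise rational of type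
`(p,p)` ("a flat section of the VHS which is a Hodge class at every fibre"): IF `W|_{𝒳_s}` is algebraic at every point
of SOME set `Λ` of CM fibres that is Zariski-dense on points, THEN `W|_{𝒳_t}` is algebraic at every `t ∈ S(ℂ)`. No
density hypothesis on the whole CM locus is needed (it follows from `Λ`'s). Nearest print: the structure theorem
(the algebraicity locus is a countable union of closed strata) and Cattani–Deligne–Kaplan (the HODGE locus is
algebraic) — neither gives it; for ABSOLUTE HODGE in place of algebraic it is Deligne's Principle B. Implied by
`AbelianSchemeVHC` (one anchor suffices there) and by `HC_AV`; implies U_Z and U. NOT asserted.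
[cite: CharlesSchnell2014Notes, Conj. 11.3.1, Prop. 11.3.11 and Thm. 11.5.11] [cite: Deligne1982HodgeCycles, Thm.
2.12]
[cite: CattaniDeligneKaplan1995, Thm. 1.1] [status: open] -/
@[conjecture] def SpreadFromZariskiDenseCMPoints : Prop :=
  ∀ ⦃n : ℕ⦄ ⦃𝒳 S : SchemeOver ℂ⦄ (f : 𝒳 ⟶ S), IsSmoothProjectiveFamily f n →
    IsQuasiProjectiveOver 𝒳 → IsQuasiProjectiveOver S → IrreducibleSpace S.left → AlgebraicGeometry.Smooth S.hom →
    (∀ s : ComplexPoints S, ∃ A' : AbelianVariety ℂ, A'.dim = n ∧ Nonempty (A'.X ≅ fiberOver f s)) →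
    ∀ (p : ℕ) (W : complexBetti 𝒳 (2 * p)),
      (∀ s : ComplexPoints S, IsRationalClass (complexBetti.map (fiberι f s) (2 * p) W) ∧
        IsOfHodgeType n (fiberOver f s) (2 * p) p p (complexBetti.map (fiberι f s) (2 * p) W)) →
      ∀ (Λ : Set (ComplexPoints S)), Λ ⊆ cmLocus f n → zariskiClosureOnPoints Λ = Set.univ →
        (∀ s ∈ Λ, complexBetti.map (fiberι f s) (2 * p) W ∈ algebraicClasses (fiberOver f s) p) →
        ∀ t : ComplexPoints S, complexBetti.map (fiberι f t) (2 * p) W ∈ algebraicClasses (fiberOver f t) p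

/-- **U_Z — `SpreadFromZariskiDenseCMLocus` (OPEN; the premise-at-ALL-CM-fibres form with only ZARISKI density of
the CM locus).** Same families as S_ZD but with CM locus Zariski-dense on points; IF `W|_{𝒳_s}` is algebraic at EVERY
CM fibre THEN it is algebraic at every fibre. Between S_ZD and U: `S_ZD ⟹ U_Z ⟹ U`, and `U ⟹ U_Z` granted the
André–Oort-shaped upgrade `ZariskiDenseCMLocusIsDense`. Like U (and unlike S_ZD) its premise quantifies over ALL CM
fibres, which nothing in print discharges except `HC_CM`. NOT asserted.
[cite: CharlesSchnell2014Notes, Conj. 11.3.1 and Thm. 11.5.11] [cite: Pila2022, Conj. 6.4 and Thm. 6.6] [status: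
open] -/
@[conjecture] def SpreadFromZariskiDenseCMLocus : Prop :=
  ∀ ⦃n : ℕ⦄ ⦃𝒳 S : SchemeOver ℂ⦄ (f : 𝒳 ⟶ S), IsSmoothProjectiveFamily f n →
    IsQuasiProjectiveOver 𝒳 → IsQuasiProjectiveOver S → IrreducibleSpace S.left → AlgebraicGeometry.Smooth S.hom →
    (∀ s : ComplexPoints S, ∃ A' : AbelianVariety ℂ, A'.dim = n ∧ Nonempty (A'.X ≅ fiberOver f s)) →
    zariskiClosureOnPoints (cmLocus f n) = Set.univ →
    ∀ (p : ℕ) (W : complexBetti 𝒳 (2 * p)),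
      (∀ s : ComplexPoints S, IsRationalClass (complexBetti.map (fiberι f s) (2 * p) W) ∧
        IsOfHodgeType n (fiberOver f s) (2 * p) p p (complexBetti.map (fiberι f s) (2 * p) W)) →
      (∀ s ∈ cmLocus f n, complexBetti.map (fiberι f s) (2 * p) W ∈ algebraicClasses (fiberOver f s) p) →
      ∀ t : ComplexPoints S, complexBetti.map (fiberι f t) (2 * p) W ∈ algebraicClasses (fiberOver f t) p

/-- **`ZariskiDenseCMLocusIsDense` — the André–Oort-shaped density upgrade (typed HYPOTHESIS; an INFERENCE from
print, not verbatim print).** On a smooth projective family with quasi-projective total space and base, smooth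
irreducible base and abelian charts at every fibre, a CM locus that is Zariski-dense on points is dense in `S(ℂ)`.
Informal derivation (ours): étale-locally the family is a polarized abelian scheme with level structure, classified by
an algebraic map `φ : S' → 𝒜_{g,n}` (Borel); the Zariski closure of the CM points of `φ(S')` is then all of
`closure φ(S')`, which by ANDRÉ–OORT FOR `𝒜_g` (Tsimerman 2018; general Shimura varieties: Pila–Shankar–Tsimerman
with Esnault–Groechenig, "AO holds in general") is a special subvariety, in which CM points are analytically dense;
generic flatness makes `φ` open over a dense open, so density lifts to `S(ℂ)`. CAVEAT (referee F-ref2-49): the CM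
locus of `f` is `φ⁻¹(CM points)` only after choosing a relative polarisation and a level structure, which exist
étale-locally on `S`; for a family with abelian CHARTS at every fibre (no global polarisation is assumed in the scope)
the reduction to `𝒜_{g,n}` is LOCAL on `S` — enough for a density statement, which is local on the base. The tree has
no Shimura varieties or special subvarieties, so André–Oort itself is NOT typed; this corollary-shaped statement on the
tree's carriers is a HYPOTHESIS wherever used, never a cited fact. With it `U ⟹ U_Z`
(`spreadFromZariskiDenseCMLocus_of_uniform_of_aoDense`).
NOT asserted. [cite: Tsimerman2018, Thm. 1.1] [cite: PilaEtAl2021, Thm. 1.1] [cite: Pila2022, Conj. 6.4, Thm. 6.6 and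
Thm. 6.7 (pp. 41–43)] [cite: Deligne1982HodgeCycles, §6 p. 61 (Borel's theorem: `ψ : S → M_n` is algebraic)]
[status: open] -/
@[conjecture] def ZariskiDenseCMLocusIsDense : Prop :=
  ∀ ⦃n : ℕ⦄ ⦃𝒳 S : SchemeOver ℂ⦄ (f : 𝒳 ⟶ S), IsSmoothProjectiveFamily f n →
    IsQuasiProjectiveOver 𝒳 → IsQuasiProjectiveOver S → IrreducibleSpace S.left → AlgebraicGeometry.Smooth S.hom →
    (∀ s : ComplexPoints S, ∃ A' : AbelianVariety ℂ, A'.dim = n ∧ Nonempty (A'.X ≅ fiberOver f s)) →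
    zariskiClosureOnPoints (cmLocus f n) = Set.univ → Dense (cmLocus f n)

/-! ### The kernel order `S_ZD ⟹ U_Z ⟹ U` (and back up granted André–Oort) -/

/-- `S_ZD ⟹ U_Z`: take `Λ =` the whole CM locus. [folklore] -/
theorem spreadFromZariskiDenseCMLocus_of_spreadFromZariskiDenseCMPoints (h : SpreadFromZariskiDenseCMPoints) :
    SpreadFromZariskiDenseCMLocus :=
  fun _ _ _ f hf h𝒳 hS hirr hsm hab hZ p W hW hcm =>
    h f hf h𝒳 hS hirr hsm hab p W hW (cmLocus f _) subset_rfl hZ hcm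

/-- `U_Z ⟹ U`: a dense CM locus is Zariski-dense on points, and algebraic everywhere is uniformly algebraic along any
set (`Ring2.Deform.exists_closed_stratum_of_forall`). [folklore] -/
theorem uniform_of_spreadFromZariskiDenseCMLocus (h : SpreadFromZariskiDenseCMLocus) :
    UniformAlgebraicityAtCMPoints := by
  intro n 𝒳 S f hf h𝒳 hS hirr hsm hab hD p W hW hcm
  exact exists_closed_stratum_of_forall f
    (h f hf h𝒳 hS hirr hsm hab (zariskiClosureOnPoints_eq_univ_of_dense hD) p W hW hcm) _

/-- `S_ZD ⟹ U`. [folklore] -/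
theorem uniform_of_spreadFromZariskiDenseCMPoints (h : SpreadFromZariskiDenseCMPoints) :
    UniformAlgebraicityAtCMPoints :=
  uniform_of_spreadFromZariskiDenseCMLocus (spreadFromZariskiDenseCMLocus_of_spreadFromZariskiDenseCMPoints h)

/-- `U ∧ ZariskiDenseCMLocusIsDense ⟹ U_Z`: with the André–Oort-shaped upgrade a Zariski-dense CM locus is dense, U
gives one closed stratum of algebraic fibres containing it, and the Zariski spreading lemma finishes. So U and U_Z are
EQUIVALENT granted the upgrade (`spreadFromZariskiDenseCMLocus_iff_uniform_of_aoDense`). [cite: Pila2022, Thm. 6.6] -/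
theorem spreadFromZariskiDenseCMLocus_of_uniform_of_aoDense (hU : UniformAlgebraicityAtCMPoints)
    (hAO : ZariskiDenseCMLocusIsDense) : SpreadFromZariskiDenseCMLocus := by
  intro n 𝒳 S f hf h𝒳 hS hirr hsm hab hZ p W hW hcm t
  obtain ⟨W₀, hWc, hWalg, hcmW⟩ := hU f hf h𝒳 hS hirr hsm hab (hAO f hf h𝒳 hS hirr hsm hab hZ) p W hW hcm
  exact forall_mem_algebraicClasses_of_zariskiDense_of_subset_closed f hZ hWc hWalg hcmW t

/-- `U_Z ↔ U` granted `ZariskiDenseCMLocusIsDense`. [cite: Pila2022, Thm. 6.6 and Thm. 6.7] -/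
theorem spreadFromZariskiDenseCMLocus_iff_uniform_of_aoDense (hAO : ZariskiDenseCMLocusIsDense) :
    SpreadFromZariskiDenseCMLocus ↔ UniformAlgebraicityAtCMPoints :=
  ⟨uniform_of_spreadFromZariskiDenseCMLocus, fun hU => spreadFromZariskiDenseCMLocus_of_uniform_of_aoDense hU hAO⟩

/-! ### Above S_ZD: blanket VHC, `HC_AV`, the summit (ON-PATH lemmas) -/

/-- **`AbelianSchemeVHC ⟹ S_ZD`** (one anchor suffices for VHC; a Zariski-dense set of CM anchors on a family with a
complex point is non-empty). The converse is not claimed. [cite: CharlesSchnell2014Notes, Conj. 11.3.1] -/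
theorem spreadFromZariskiDenseCMPoints_of_abelianSchemeVHC (hV : AbelianSchemeVHC) :
    SpreadFromZariskiDenseCMPoints := by
  intro n 𝒳 S f hf _ _ hirr hsm hab p W hW Λ _ hΛ hΛalg t
  obtain ⟨s₀, hs₀⟩ := nonempty_of_zariskiClosureOnPoints_eq_univ hΛ t
  exact hV f hf hirr hsm hab p W hW ⟨s₀, hΛalg s₀ hs₀⟩ t

/-- ON-PATH: `HC_AV ⟹ S_ZD` (through `AbelianSchemeVHC`, `Hypotheses.abelianSchemeVHC_of_hc_av`).
[cite: CharlesSchnell2014Notes, Cor. 11.3.6] -/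
theorem spreadFromZariskiDenseCMPoints_of_HC_AV (h : PadicSemiregularLift.HodgeAbelianVarieties) :
    SpreadFromZariskiDenseCMPoints :=
  spreadFromZariskiDenseCMPoints_of_abelianSchemeVHC (Hypotheses.abelianSchemeVHC_of_hc_av h)

/-- ON-PATH: `HC_AV ⟹ U_Z`. [cite: CharlesSchnell2014Notes, Cor. 11.3.6] -/
theorem spreadFromZariskiDenseCMLocus_of_HC_AV (h : PadicSemiregularLift.HodgeAbelianVarieties) :
    SpreadFromZariskiDenseCMLocus :=
  spreadFromZariskiDenseCMLocus_of_spreadFromZariskiDenseCMPoints (spreadFromZariskiDenseCMPoints_of_HC_AV h)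

/-- ON-PATH: `HodgeConjecture ⟹ S_ZD`. [folklore] -/
theorem spreadFromZariskiDenseCMPoints_of_hodgeConjecture (h : _root_.HodgeConjecture) :
    SpreadFromZariskiDenseCMPoints :=
  spreadFromZariskiDenseCMPoints_of_HC_AV (HC_AV_of_hodgeConjecture h)

/-- ON-PATH: `HodgeConjecture ⟹ U_Z`. [folklore] -/
theorem spreadFromZariskiDenseCMLocus_of_hodgeConjecture (h : _root_.HodgeConjecture) :
    SpreadFromZariskiDenseCMLocus :=
  spreadFromZariskiDenseCMLocus_of_HC_AV (HC_AV_of_hodgeConjecture h)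


/-! ## §3 Exact complements of `HC_CM`: the brief's deliverable shape for each candidate, and why "smaller" must
mean "weaker standalone" -/

/-- **`HC_AV_of_HC_CM_and_spreadZD`** — the brief's `HC_AV_of_HC_CM_and_Bmin` with `B_min := S_ZD`, granted the
refereed family fact: `HC_CM → S_ZD → HC_AV` (through `S_ZD ⟹ U` and deform's print-backed row U, where `HC_CM` is
consumed at every CM fibre of the Mumford–Tate family). CONDITIONAL on `HC_CM` (OPEN) and S_ZD (OPEN; §4: S_ZD makes
`HC_CM` idle). [cite: CharlesSchnell2014Notes, Thm. 11.5.11 and Prop. 11.3.11] [cite: Deligne1982HodgeCycles, Prop.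
6.1] -/
theorem HC_AV_of_HC_CM_and_spreadZD (hF : deligne1982_cmDenseMumfordTateFamilies)
    (hCM : RankFourFaces.CMAbelianHodge) (hS : SpreadFromZariskiDenseCMPoints) :
    PadicSemiregularLift.HodgeAbelianVarieties :=
  HC_AV_of_deligne1982_of_HC_CM_of_uniform hF hCM (uniform_of_spreadFromZariskiDenseCMPoints hS)

/-- **`HC_AV_of_HC_CM_and_spreadZDLocus`** — the same with `B_min := U_Z`. [cite: CharlesSchnell2014Notes, Thm.
11.5.11] -/
theorem HC_AV_of_HC_CM_and_spreadZDLocus (hF : deligne1982_cmDenseMumfordTateFamilies)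
    (hCM : RankFourFaces.CMAbelianHodge) (hZ : SpreadFromZariskiDenseCMLocus) :
    PadicSemiregularLift.HodgeAbelianVarieties :=
  HC_AV_of_deligne1982_of_HC_CM_of_uniform hF hCM (uniform_of_spreadFromZariskiDenseCMLocus hZ)

/-- **The deliverable in the brief's literal shape, `B_min := S_ZD`**: `HC_CM → S_ZD → ∀ A` (complex abelian variety,
smooth projective guard of item 16267) `, HodgeConjectureFor A.dim A.X`, granted the refereed family fact.
[cite: CharlesSchnell2014Notes, Thm. 11.5.11] [cite: Deligne1982HodgeCycles, Prop. 6.1] -/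
theorem hodgeConjectureFor_abelian_of_HC_CM_and_spreadZD (hF : deligne1982_cmDenseMumfordTateFamilies)
    (hCM : RankFourFaces.CMAbelianHodge) (hS : SpreadFromZariskiDenseCMPoints) :
    ∀ A : AbelianVariety ℂ, IsSmoothProjective A.dim A.X → HodgeConjectureFor A.dim A.X :=
  cmToAbelian_of_deligne1982_of_uniform hF (uniform_of_spreadFromZariskiDenseCMPoints hS) hCM

/-- **The deliverable in the brief's literal shape, `B_min := U`** (deform's input; the spread-side minimum):
`HC_CM → U → ∀ A, HodgeConjectureFor A.dim A.X`, granted the refereed family fact — deform's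
`cmToAbelian_of_deligne1982_of_uniform` with the binders in the brief's order. [cite: CharlesSchnell2014Notes, Thm.
11.5.11] -/
theorem hodgeConjectureFor_abelian_of_HC_CM_and_uniform (hF : deligne1982_cmDenseMumfordTateFamilies)
    (hCM : RankFourFaces.CMAbelianHodge) (hU : UniformAlgebraicityAtCMPoints) :
    ∀ A : AbelianVariety ℂ, IsSmoothProjective A.dim A.X → HodgeConjectureFor A.dim A.X :=
  cmToAbelian_of_deligne1982_of_uniform hF hU hCM

/-- **EXACTNESS for S_ZD**: `HC_AV ↔ HC_CM ∧ S_ZD` granted the refereed family fact. [cite: CharlesSchnell2014Notes,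
Cor. 11.3.6 and Thm. 11.5.11] -/
theorem HC_AV_iff_HC_CM_and_spreadZD (hF : deligne1982_cmDenseMumfordTateFamilies) :
    PadicSemiregularLift.HodgeAbelianVarieties ↔
      (RankFourFaces.CMAbelianHodge ∧ SpreadFromZariskiDenseCMPoints) :=
  ⟨fun h => ⟨HC_CM_of_HC_AV h, spreadFromZariskiDenseCMPoints_of_HC_AV h⟩,
    fun h => HC_AV_of_HC_CM_and_spreadZD hF h.1 h.2⟩

/-- **EXACTNESS for U_Z**: `HC_AV ↔ HC_CM ∧ U_Z` granted the refereed family fact. [cite: CharlesSchnell2014Notes,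
Cor. 11.3.6 and Thm. 11.5.11] -/
theorem HC_AV_iff_HC_CM_and_spreadZDLocus (hF : deligne1982_cmDenseMumfordTateFamilies) :
    PadicSemiregularLift.HodgeAbelianVarieties ↔
      (RankFourFaces.CMAbelianHodge ∧ SpreadFromZariskiDenseCMLocus) :=
  ⟨fun h => ⟨HC_CM_of_HC_AV h, spreadFromZariskiDenseCMLocus_of_HC_AV h⟩,
    fun h => HC_AV_of_HC_CM_and_spreadZDLocus hF h.1 h.2⟩

/-- **Item 16267 read through S_ZD**: `CMToAbelian ↔ (HC_CM → S_ZD)` granted the refereed family fact.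
[cite: CharlesSchnell2014Notes, Thm. 11.5.11 and Conj. 11.3.1] -/
theorem cmToAbelian_iff_HC_CM_imp_spreadZD (hF : deligne1982_cmDenseMumfordTateFamilies) :
    RankFourFaces.CMToAbelian ↔ (RankFourFaces.CMAbelianHodge → SpreadFromZariskiDenseCMPoints) := by
  constructor
  · intro h hCM
    exact spreadFromZariskiDenseCMPoints_of_HC_AV (Hypotheses.hc_av_iff_hc_cm_and_cmToAbelian.2 ⟨hCM, h⟩)
  · intro h hCM A hA
    exact hodgeConjectureFor_abelian_of_HC_CM_and_spreadZD hF hCM (h hCM) A hA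

/-- **Why "smallest `B_min`" cannot be read under `HC_CM`.** Every EXACT complement `X` of `HC_CM` — on-path
(`HC_AV → X`) and closing (`HC_CM → X → HC_AV`) — is, under `HC_CM`, EQUIVALENT to U (and to `HC_AV`, and to every
other exact complement): granted `HC_CM` the candidates cannot be told apart. Comparisons between candidates are
therefore meaningful only STANDALONE (without `HC_CM`): the kernel order of §2 and the domination of §4.
[cite: CharlesSchnell2014Notes, Cor. 11.3.6] -/
theorem complement_iff_uniform_of_HC_CM (hF : deligne1982_cmDenseMumfordTateFamilies) {X : Prop}
    (hon : PadicSemiregularLift.HodgeAbelianVarieties → X)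
    (hcl : RankFourFaces.CMAbelianHodge → X → PadicSemiregularLift.HodgeAbelianVarieties)
    (hCM : RankFourFaces.CMAbelianHodge) : X ↔ UniformAlgebraicityAtCMPoints :=
  ⟨fun hX => uniformAlgebraicityAtCMPoints_of_HC_AV (hcl hCM hX),
    fun hU => hon (HC_AV_of_deligne1982_of_HC_CM_of_uniform hF hCM hU)⟩

/-- Corollary: under `HC_CM`, any two exact complements are equivalent. [folklore] -/
theorem complements_iff_of_HC_CM (hF : deligne1982_cmDenseMumfordTateFamilies) {X Y : Prop}
    (honX : PadicSemiregularLift.HodgeAbelianVarieties → X)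
    (hclX : RankFourFaces.CMAbelianHodge → X → PadicSemiregularLift.HodgeAbelianVarieties)
    (honY : PadicSemiregularLift.HodgeAbelianVarieties → Y)
    (hclY : RankFourFaces.CMAbelianHodge → Y → PadicSemiregularLift.HodgeAbelianVarieties)
    (hCM : RankFourFaces.CMAbelianHodge) : X ↔ Y :=
  (complement_iff_uniform_of_HC_CM hF honX hclX hCM).trans (complement_iff_uniform_of_HC_CM hF honY hclY hCM).symm

/-- **Census of the spread axis (kernel form of RING2-MAP §AbelianAll, spread rows).** Granted only the refereed
family fact: the three candidates are exact complements and linearly ordered, `S_ZD ⟹ U_Z ⟹ U`, each between `HC_AV`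
and `CMToAbelian`'s content. [cite: CharlesSchnell2014Notes, Thm. 11.5.11, Conj. 11.3.1 and Cor. 11.3.6] -/
theorem spreadAxis_census (hF : deligne1982_cmDenseMumfordTateFamilies) :
    (PadicSemiregularLift.HodgeAbelianVarieties → SpreadFromZariskiDenseCMPoints) ∧
    (SpreadFromZariskiDenseCMPoints → SpreadFromZariskiDenseCMLocus) ∧
    (SpreadFromZariskiDenseCMLocus → UniformAlgebraicityAtCMPoints) ∧
    (PadicSemiregularLift.HodgeAbelianVarieties ↔
      (RankFourFaces.CMAbelianHodge ∧ SpreadFromZariskiDenseCMPoints)) ∧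
    (PadicSemiregularLift.HodgeAbelianVarieties ↔
      (RankFourFaces.CMAbelianHodge ∧ SpreadFromZariskiDenseCMLocus)) ∧
    (PadicSemiregularLift.HodgeAbelianVarieties ↔
      (RankFourFaces.CMAbelianHodge ∧ UniformAlgebraicityAtCMPoints)) :=
  ⟨spreadFromZariskiDenseCMPoints_of_HC_AV, spreadFromZariskiDenseCMLocus_of_spreadFromZariskiDenseCMPoints,
    uniform_of_spreadFromZariskiDenseCMLocus, HC_AV_iff_HC_CM_and_spreadZD hF, HC_AV_iff_HC_CM_and_spreadZDLocus hF,
    HC_AV_iff_HC_CM_and_uniform_of_deligne1982 hF⟩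

end Summit.HodgeConjecture.HodgeConjecture.Ring2.AbelianAll

end
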